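import Summits.CriticalPhenomena.PercolationContinuityZ3.Theses.PercVarianceSandwich
import Summits.CriticalPhenomena.PercolationContinuityZ3.Theorems.PercNearOneGluingNoHeavyLowerTailCSHTheoremOne
import Literature.Probability.Percolation.InfiniteClusterDensity
import Literature.Probability.LatticeModels.GinibreCharacterExpansion
import Literature.Probability.Percolation.CriticalTwoArmsPersistence
import Literature.Probability.Percolation.SharpnessDCTProofs
import Mathlib.Analysis.PSeries
import Mathlib.Analysis.Complex.Exponential
import HarnessLib

/-!
# `PercVarianceSandwich.FiniteClusterMomentsOfTheta` (stmt-CriticalPhenomena-6065) — SETTLED after continuity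

Item `stmt-CriticalPhenomena-6065` of route `CriticalPhenomena/PercVarianceSandwich` (crux (rank 2)): on `{θ(p) > 0}` the finite cluster has all moments: `Σ_{x ∈ (ℤ³)^k} P_p(0 ↔ x_1, …, 0 ↔ x_k, |C(0)| < ∞) < ∞` for every `k`.

With `θ(p_c(ℤ³)) = 0` (p205010) every percolating `p` is strictly supercritical, where the tree PROVES the Kesten–Zhang / Grimmett Thm (8.65) sub-exponential volume tail `P_p(n ≤ |C(0)| < ∞) ≤ exp(−η n^{2/3})` (`Grimmett1999_thm_8_65_holds`); `x_i ∈ C(0)` forces `|C(0)| ≥ |x_{ij}| + 1` (`le_encard_openCluster_of_walk`), so each summand is `≤ exp(−η(|x_{ij}|+1)^{2/3})` for every coordinate; the geometric mean over the `3k` coordinates bounds it by a PRODUCT `∏_{ij} exp(−(η/3k)(|x_{ij}|+1)^{2/3})`, which is summable over `(ℤ³)^k` by `summable_prod_norm` (`∑ₙ ∏ₐ = ∏ₐ ∑ₘ`) and the one-dimensional bound `exp(−ct) ≤ 6/(ct)³`.  (The item's live case was a percolating `p_c`; p205010 removes it.)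

builds on p205010 (kernel theorem, internal audit signed; external expert review pending) — USED (`CSH.percolationContinuityZ3_holds`).  RSW3 lane, lead gen 28 (prover-prim-rsw3-lead-g28-0):
'after continuity — the ledger harvest'.
References: G. Kozma, N. Nitzan (2024), Thm. 6 / Conj. 3 [KozmaNitzan2024]; G. Grimmett, *Percolation* (1999), §8 [GrimmettPercolation1999].
-/

noncomputable section

namespace Summit.CriticalPhenomena.PercolationContinuityZ3.Theorems

namespace PercVarianceSandwichFiniteClusterMomentsOfTheta

open MeasureTheory Literature.Probability.Percolation Literature.Probability.LatticeModels
open DCT16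

/-- `Σ_{m ∈ ℤ} exp(−c (|m|+1)^{2/3}) < ∞` for `c > 0` (from `x³/3! ≤ eˣ` and the `p`-series, `p = 2`). [folklore] -/
theorem summable_exp_neg_rpow_twoThirds {c : ℝ} (hc : 0 < c) :
    Summable fun m : ℤ => Real.exp (-(c * (|(m : ℝ)| + 1) ^ ((2 : ℝ) / 3))) := by
  have key : ∀ m : ℤ, Real.exp (-(c * (|(m : ℝ)| + 1) ^ ((2 : ℝ) / 3))) ≤ 6 / c ^ 3 * (1 / (|(m : ℝ)| + 1) ^ 2) := by
    intro m
    set t : ℝ := (|(m : ℝ)| + 1) ^ ((2 : ℝ) / 3) with ht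
    have hm0 : 0 < |(m : ℝ)| + 1 := by positivity
    have ht0 : 0 < t := by rw [ht]; positivity
    have hct : 0 ≤ c * t := by positivity
    have h3 : (c * t) ^ 3 / (Nat.factorial 3 : ℕ) ≤ Real.exp (c * t) := Real.pow_div_factorial_le_exp (c * t) hct 3
    have h6 : ((Nat.factorial 3 : ℕ) : ℝ) = 6 := by norm_num [Nat.factorial]
    rw [h6] at h3
    have ht3 : t ^ 3 = (|(m : ℝ)| + 1) ^ 2 := by
      rw [ht, ← Real.rpow_natCast, ← Real.rpow_mul hm0.le]
      norm_num
    have hexp : 0 < Real.exp (c * t) := Real.exp_pos _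
    have hct3 : 0 < (c * t) ^ 3 := by positivity
    rw [Real.exp_neg]
    calc (Real.exp (c * t))⁻¹ ≤ 6 / (c * t) ^ 3 := by
          rw [inv_eq_one_div, div_le_div_iff₀ hexp hct3]; nlinarith
      _ = 6 / c ^ 3 * (1 / (|(m : ℝ)| + 1) ^ 2) := by rw [mul_pow, ht3, div_mul_div_comm, mul_one]
  refine Summable.of_nonneg_of_le (fun m => (Real.exp_pos _).le) key (Summable.mul_left _ ?_)
  have hnat : Summable fun n : ℕ => 1 / ((n : ℝ) + 1) ^ 2 := by
    have h := (summable_nat_add_iff 1).2 (Real.summable_one_div_nat_pow.2 one_lt_two)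
    refine h.congr fun n => ?_
    push_cast; ring
  refine Summable.of_nat_of_neg ?_ ?_
  · refine hnat.congr fun n => ?_
    simp [Nat.abs_cast]
  · refine hnat.congr fun n => ?_
    simp [Nat.abs_cast]

/-- **`PercVarianceSandwich.FiniteClusterMomentsOfTheta` (stmt-CriticalPhenomena-6065), settled.**  p205010 ⇒ `p > p_c`; Grimmett (8.65) volume tail + `|C(0)| ≥ |x_{ij}|+1` + geometric-mean product bound + `summable_prod_norm`.
[cite: KozmaNitzan2024, Thm. 6 with Conj. 3 (p. 15)] -/
theorem finiteClusterMomentsOfTheta_proof : Summit.CriticalPhenomena.PercolationContinuityZ3.Theses.PercVarianceSandwich.FiniteClusterMomentsOfTheta := by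
  classical
  intro p hθ k
  -- every percolating parameter is strictly supercritical (p205010)
  have hp : criticalProb (zdGraph 3) (0 : Site 3) < (p : ℝ) := by
    have hle := KestenZhang.criticalProb_le_of_theta_pos_zd hθ
    rcases hle.eq_or_lt with heq | hlt
    · exfalso
      have hp' : p = criticalProbI 3 := Subtype.ext (by rw [coe_criticalProbI]; exact heq.symm)
      rw [hp', show theta (zdGraph 3) (0 : Site 3) (criticalProbI 3) = 0 from CSH.percolationContinuityZ3_holds] at hθ
      exact lt_irrefl _ hθ
    · exact hlt
  -- Kesten–Zhang / Grimmett Thm (8.65): `P_p(n ≤ |C(0)| < ∞) ≤ exp(−η n^{2/3})`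
  obtain ⟨η, hη, hKZ⟩ := Grimmett1999_thm_8_65_holds 3 (by norm_num) p hp
  set μ := bondPercolation (zdGraph 3) p with hμ
  set f : (Fin k → Site 3) → ℝ := fun x => μ.real ((⋂ i, openConn 0 (x i)) \ percolatesAt 0) with hf
  rcases Nat.eq_zero_or_pos k with rfl | hk
  · exact .of_finite
  -- per-coordinate bound: all `x i ∈ C(0)` and `|C(0)| < ∞` force `|x i j| + 1 ≤ |C(0)| < ∞`
  have hcoord : ∀ (x : Fin k → Site 3) (i : Fin k) (j : Fin 3),
      f x ≤ Real.exp (-(η * (|((x i j : ℤ) : ℝ)| + 1) ^ ((2 : ℝ) / 3))) := by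
    intro x i j
    set n : ℕ := (x i j).natAbs + 1 with hn
    have h1 : f x ≤ μ.real {ω | (n : ℕ∞) ≤ (openCluster ω 0).encard ∧ (openCluster ω 0).Finite} := by
      refine real_mono_of_forall_subset_edgeSet (zdGraph 3) p fun ω hω hmem => ?_
      obtain ⟨hall, hnot⟩ := hmem
      have hi : ω ∈ openConn (0 : Site 3) (x i) := Set.mem_iInter.1 hall i
      have hreach : (openGraph ω).Reachable 0 (x i) := hi
      obtain ⟨w⟩ := hreach
      have hwω : ∀ e ∈ w.edges, e ∈ ω := by
        intro e
        induction e using Sym2.ind with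
        | h a b =>
          intro he
          exact ((openGraph_adj _ _ _).1 ((SimpleGraph.mem_edgeSet _).1 (w.edges_subset_edgeSet he))).1
      have hwE : ∀ e ∈ w.edges, e ∈ (zdGraph 3).edgeSet := fun e he => hω (hwω e he)
      have hle := le_encard_openCluster_of_walk (w.transfer (zdGraph 3) hwE)
        (by rw [SimpleGraph.Walk.edges_transfer]; exact hwω) j
      refine ⟨?_, Set.not_infinite.1 hnot⟩
      simpa [hn] using hle
    have h2 := hKZ n
    have h3 : Real.exp (-(η * (n : ℝ) ^ ((((3 : ℕ) : ℝ) - 1) / ((3 : ℕ) : ℝ)))) =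
        Real.exp (-(η * (|((x i j : ℤ) : ℝ)| + 1) ^ ((2 : ℝ) / 3))) := by
      have hn' : (n : ℝ) = |((x i j : ℤ) : ℝ)| + 1 := by
        rw [hn]; push_cast; rw [Nat.cast_natAbs]; push_cast; ring
      rw [hn']; norm_num
    exact h1.trans (h2.trans h3.le)
  -- geometric mean over the `3k` coordinates: `f x ≤ ∏_{i,j} exp(−(η/3k)(|x i j|+1)^{2/3})`
  set c : ℝ := η / (3 * k : ℕ) with hc
  have hcpos : 0 < c := by rw [hc]; positivity
  have hgm : ∀ x : Fin k → Site 3, f x ≤ ∏ i, ∏ j, Real.exp (-(c * (|((x i j : ℤ) : ℝ)| + 1) ^ ((2 : ℝ) / 3))) := by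
    intro x
    have hf0 : 0 ≤ f x := measureReal_nonneg
    have hK : ((3 * k : ℕ) : ℝ) ≠ 0 := by positivity
    calc f x = ∏ _i : Fin k, ∏ _j : Fin 3, (f x) ^ ((1 : ℝ) / (3 * k : ℕ)) := by
          simp only [Finset.prod_const, Finset.card_univ, Fintype.card_fin]
          rw [← pow_mul, ← Real.rpow_natCast, ← Real.rpow_mul hf0]
          rw [show (1 : ℝ) / ((3 * k : ℕ) : ℝ) * ((3 * k : ℕ) : ℝ) = 1 by field_simp, Real.rpow_one]
      _ ≤ ∏ i, ∏ j, (Real.exp (-(η * (|((x i j : ℤ) : ℝ)| + 1) ^ ((2 : ℝ) / 3)))) ^ ((1 : ℝ) / (3 * k : ℕ)) := by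
          refine Finset.prod_le_prod (fun i _ => Finset.prod_nonneg fun j _ => by positivity) fun i _ => ?_
          refine Finset.prod_le_prod (fun j _ => by positivity) fun j _ => ?_
          exact Real.rpow_le_rpow hf0 (hcoord x i j) (by positivity)
      _ = ∏ i, ∏ j, Real.exp (-(c * (|((x i j : ℤ) : ℝ)| + 1) ^ ((2 : ℝ) / 3))) := by
          refine Finset.prod_congr rfl fun i _ => Finset.prod_congr rfl fun j _ => ?_
          rw [← Real.exp_mul, hc]
          congr 1
          field_simp
  -- summability of the product bound (`∑ₙ ∏ₐ = ∏ₐ ∑ₘ` on `ι = Fin k × Fin 3`)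
  have h1d : Summable fun m : ℤ => Real.exp (-(c * (|(m : ℝ)| + 1) ^ ((2 : ℝ) / 3))) :=
    summable_exp_neg_rpow_twoThirds hcpos
  have hprod : Summable fun n : Fin k × Fin 3 → ℤ =>
      ∏ a, ‖((Real.exp (-(c * (|((n a : ℤ) : ℝ)| + 1) ^ ((2 : ℝ) / 3))) : ℝ) : ℂ)‖ :=
    summable_prod_norm (c := fun _ m => ((Real.exp (-(c * (|(m : ℝ)| + 1) ^ ((2 : ℝ) / 3))) : ℝ) : ℂ))
      (fun a => h1d.congr fun m => by rw [Complex.norm_real, Real.norm_of_nonneg (Real.exp_pos _).le])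
  let e : (Fin k → Site 3) ≃ (Fin k × Fin 3 → ℤ) := (Equiv.curry (Fin k) (Fin 3) ℤ).symm
  have hB : Summable fun x : Fin k → Site 3 => ∏ i, ∏ j, Real.exp (-(c * (|((x i j : ℤ) : ℝ)| + 1) ^ ((2 : ℝ) / 3))) := by
    have h := (e.summable_iff (f := fun n : Fin k × Fin 3 → ℤ =>
      ∏ a, ‖((Real.exp (-(c * (|((n a : ℤ) : ℝ)| + 1) ^ ((2 : ℝ) / 3))) : ℝ) : ℂ)‖)).2 hprod
    refine h.congr fun x => ?_
    simp only [e, Fintype.prod_prod_type, Complex.norm_real, Real.norm_of_nonneg (Real.exp_pos _).le]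
    rfl
  exact Summable.of_nonneg_of_le (fun x => measureReal_nonneg) hgm hB

end PercVarianceSandwichFiniteClusterMomentsOfTheta

end Summit.CriticalPhenomena.PercolationContinuityZ3.Theorems

end
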